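import Literature.Geometry.Symplectic.GromovR4RelEndProofs
import Literature.Topology.FourManifolds.ClosedBall
import Mathlib.Analysis.Calculus.FDeriv.Symmetric
import Mathlib.Analysis.Calculus.FDeriv.Bilinear
import Mathlib.Analysis.Calculus.FDeriv.CompCLM
import Mathlib.Analysis.Calculus.ContDiff.Comp
import Mathlib.Analysis.InnerProductSpace.PiL2

/-!
# Stub `stub_symplectic_of_liouville` of line `contact-isotopy-gromov-cone` for crux `SchoenfliesSplit.SchsplitCerf` (stmt-SmoothPoincare4-8758)

Exterior derivative of the Liouville identity on an open subset of `ℝ⁴` (pure calculus).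
If `F : ℝ⁴ → ℝ⁴` is `C^∞` at every point of an open set `U` and
`ω₀(F x, DF_x w) = ω₀(x, w)` for all `x ∈ U`, `w ∈ ℝ⁴` (that is `F^*λ₀ = λ₀` on `U` with
`λ₀ = ½ ι_x ω₀`), then `ω₀(DF_x v, DF_x w) = ω₀(v, w)` on `U` (`F^*ω₀ = ω₀`, as `ω₀ = dλ₀`).

Proof: differentiate the hypothesis (an identity between functions of `x` on the open set `U`)
at `x` in the direction `v`, using the product rule for the continuous bilinear map
`stdSymplecticBilin` (`ContinuousLinearMap.hasFDerivAt_of_bilinear`) and the derivative of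
`y ↦ DF_y w` (`HasFDerivAt.clm_apply`; `DF` is differentiable at `x` by
`ContDiffAt.fderiv_right`):
`ω₀(DF v, DF w) + ω₀(F x, D²F(v, w)) = ω₀(v, w)`.  Exchange `v` and `w`, subtract, and use the
antisymmetry of `ω₀` (`stdSymplecticForm_swap`) together with the symmetry of `D²F`
(`ContDiffAt.isSymmSndFDerivAt`): `2 ω₀(DF v, DF w) = 2 ω₀(v, w)`.
Source: folklore (e.g. McDuff–Salamon, *Introduction to Symplectic Topology*, §1.1: `ω₀ = dλ₀`).
-/

noncomputable section

-- the prescribed namespace `Summit.<P>.<Sub>.…` duplicates `SmoothPoincare4` (P = Sub)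
set_option linter.dupNamespace false

open scoped Manifold ContDiff Topology
open Set Function Metric
open Literature.Topology.FourManifolds Literature.Geometry.Symplectic

namespace Summit.SmoothPoincare4.SmoothPoincare4.Theorems.SchsplitCerf.ContactIsotopyGromovCone

attribute [local instance] Literature.Topology.FourManifolds.fact_finrank_euclideanSpace_succ

/-- The unit 3-sphere. -/
local notation "𝕊³" => (Metric.sphere (0 : EuclideanSpace ℝ (Fin 4)) 1)
/-- The model `ℝ⁴`. -/
local notation "E4" => EuclideanSpace ℝ (Fin 4)

namespace SymplecticOfLiouville

/-- **First-order consequence of the Liouville identity.**  If `F` is `C^∞` at every point of an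
open set `U` and `ω₀(F y, DF_y w) = ω₀(y, w)` on `U`, then differentiating at `x ∈ U` in the
direction `v` gives `ω₀(DF_x v, DF_x w) + ω₀(F x, D²F_x v w) = ω₀(v, w)`. [folklore] -/
theorem deriv_identity (F : E4 → E4) (U : Set E4) (hU : IsOpen U)
    (hF : ∀ x ∈ U, ContDiffAt ℝ ∞ F x)
    (hL : ∀ x ∈ U, ∀ w : E4, stdSymplecticForm (F x) (fderiv ℝ F x w) = stdSymplecticForm x w)
    (x : E4) (hx : x ∈ U) (v w : E4) :
    stdSymplecticForm (fderiv ℝ F x v) (fderiv ℝ F x w)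
      + stdSymplecticForm (F x) (fderiv ℝ (fderiv ℝ F) x v w) = stdSymplecticForm v w := by
  have hFx : ContDiffAt ℝ ∞ F x := hF x hx
  have hdF : DifferentiableAt ℝ F x := hFx.differentiableAt (by simp)
  have hdF' : DifferentiableAt ℝ (fderiv ℝ F) x :=
    (hFx.fderiv_right (m := ∞) le_rfl).differentiableAt (by simp)
  -- derivative of `y ↦ DF_y w`
  have h1 : HasFDerivAt (fun y => fderiv ℝ F y w) ((fderiv ℝ (fderiv ℝ F) x).flip w) x := by
    have h := hdF'.hasFDerivAt.clm_apply (hasFDerivAt_const w x)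
    simpa using h
  -- derivative of the left-hand side `y ↦ ω₀(F y, DF_y w)`
  have h2 : HasFDerivAt (fun y => stdSymplecticBilin (F y) (fderiv ℝ F y w))
      (stdSymplecticBilin.precompR E4 (F x) ((fderiv ℝ (fderiv ℝ F) x).flip w)
        + stdSymplecticBilin.precompL E4 (fderiv ℝ F x) (fderiv ℝ F x w)) x :=
    stdSymplecticBilin.hasFDerivAt_of_bilinear hdF.hasFDerivAt h1
  -- derivative of the right-hand side `y ↦ ω₀(y, w)`
  have h3 : HasFDerivAt (fun y => stdSymplecticBilin y w)
      (stdSymplecticBilin.precompR E4 x (0 : E4 →L[ℝ] E4)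
        + stdSymplecticBilin.precompL E4 (ContinuousLinearMap.id ℝ E4) w) x :=
    stdSymplecticBilin.hasFDerivAt_of_bilinear (hasFDerivAt_id x) (hasFDerivAt_const w x)
  -- the two functions agree near `x`
  have heq : (fun y => stdSymplecticBilin (F y) (fderiv ℝ F y w))
      =ᶠ[𝓝 x] (fun y => stdSymplecticBilin y w) := by
    filter_upwards [hU.mem_nhds hx] with y hy
    simp only [stdSymplecticBilin_apply]
    exact hL y hy w
  have h4 := (h3.congr_of_eventuallyEq heq).unique h2
  have h5 := congrArg (fun L : E4 →L[ℝ] ℝ => L v) h4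
  simp only [add_apply, ContinuousLinearMap.precompR_apply,
    ContinuousLinearMap.precompL_apply, ContinuousLinearMap.compL_apply,
    ContinuousLinearMap.coe_comp, Function.comp_apply, ContinuousLinearMap.flip_apply,
    ContinuousLinearMap.id_apply, map_zero, stdSymplecticBilin_apply, zero_add] at h5
  linarith [h5]

end SymplecticOfLiouville

/-- **Stub Z1b — exterior derivative of the Liouville identity (calculus on an open set
of `ℝ⁴`).**  If `F` is `C^∞` at every point of an open set `U ⊆ ℝ⁴` and
`ω₀(F x, DF_x w) = ω₀(x, w)` for all `x ∈ U`, `w ∈ ℝ⁴` (i.e. `F^*λ₀ = λ₀` on `U`,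
`λ₀ = ½ ι_x ω₀`), then `ω₀(DF_x v, DF_x w) = ω₀(v, w)` on `U` (`F^*ω₀ = ω₀`, as `ω₀ = dλ₀`).
Proof: differentiate the hypothesis at `x` in the direction `v`
(`SymplecticOfLiouville.deriv_identity`):
`ω₀(DF v, DF w) + ω₀(F x, D²F(v, w)) = ω₀(v, w)`; subtract the same identity with `v, w`
exchanged and use the antisymmetry of `ω₀` (`stdSymplecticForm_swap`) and the symmetry of `D²F`
(`ContDiffAt.isSymmSndFDerivAt`): `2 ω₀(DF v, DF w) = 2 ω₀(v, w)`. [folklore] -/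
theorem stub_symplectic_of_liouville :
    ∀ (F : E4 → E4) (U : Set E4), IsOpen U → (∀ x ∈ U, ContDiffAt ℝ ∞ F x) →
      (∀ x ∈ U, ∀ w : E4, stdSymplecticForm (F x) (fderiv ℝ F x w) = stdSymplecticForm x w) →
      ∀ x ∈ U, ∀ v w : E4,
        stdSymplecticForm (fderiv ℝ F x v) (fderiv ℝ F x w) = stdSymplecticForm v w := by
  intro F U hU hF hL x hx v w
  have hsymm : IsSymmSndFDerivAt ℝ F x := (hF x hx).isSymmSndFDerivAt
    (by rw [minSmoothness_of_isRCLikeNormedField]; exact WithTop.coe_le_coe.2 le_top)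
  have hvw := SymplecticOfLiouville.deriv_identity F U hU hF hL x hx v w
  have hwv := SymplecticOfLiouville.deriv_identity F U hU hF hL x hx w v
  rw [← hsymm.eq v w, stdSymplecticForm_swap (fderiv ℝ F x v) (fderiv ℝ F x w),
    stdSymplecticForm_swap v w] at hwv
  linarith

end Summit.SmoothPoincare4.SmoothPoincare4.Theorems.SchsplitCerf.ContactIsotopyGromovCone

end
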